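import Mathlib

/-!
# WeilLatticeLaw — kernel-checked core of LEMMA W ∕ COROLLARY W1 ∕ PROPOSITION F
(hsemireg-alphabet-isogeny-1, g1 pen + exact script `code/wlattice.py`; g2 kernel)

Frame = the cell's letter frame (`Pad4TowerLineLetters` §1, `bphi = (1, α, α, β, β̄, α² − |β|²)`): `P = (E × E′)⁴`,
`E = E′ = ℂ∕ℤ[i]`, complex coordinates `z_f` (on `E`) and `z′_f` (on `E′`) of the factor pair `S_f`, real coordinates
`z = x + i y`, `z′ = x′ + i y′`; `E_{jk} := (i∕2) dz_j ∧ dz̄_k`, `h ↔ Σ_j E_{jj}`, the box letter `β_f ↔ β_f·E_{z_f z′_f} + β̄_f·E_{z′_f z_f}`,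
so the `eeee`-word direction is `e⁴ := ∏_f E_{z_f z′_f}` and the Weil part of an (A1)-clean class is `w = μ·e⁴ + μ̄·ē⁴`,
`μ =` the `eeee` coefficient (`MConfig.wch … eWord`).  `H^*(P, ℤ)` is the exterior algebra on the sixteen real 1-forms
`dx, dy, dx′, dy′` (four per factor pair) with the INTEGER monomial basis.

MODELLING SENTENCES (pencil, one line each; everything below them is kernel arithmetic):
* (M1) `E_{z z′} = (i∕2)(dx + i dy)(dx′ − i dy′) = ½·( i·dx∧dx′ + dx∧dy′ − dy∧dx′ + i·dy∧dy′ )` and `E_{z′ z} = conj E_{z z′}`: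
  the four MIXED monomials of a factor pair, coefficients `½·eCoeff2` below; NO principal monomial `dx∧dy`, `dx′∧dy′` occurs.
* (M2) the four factor pairs use disjoint variables and 2-forms commute, so the coefficient of `e⁴` on the product monomial
  `m = (m₀, m₁, m₂, m₃)` is `(1∕16)·∏_f eCoeff2(m_f)`; these 256 product monomials are distinct integral basis elements, none of
  them a principal monomial `E_{JJ} = ∏_{j∈J} dx_j∧dy_j`.
* (M3) `P` is a real torus, so `ch : K⁰_top(P) → H^{ev}(P, ℚ)` is an isomorphism onto `H^{ev}(P, ℤ)` (Künneth for `K` and `H` of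
  `(S¹)¹⁶`; `ch(L) = exp(c₁(L)) = Σ_I Pf(c₁|_I) dx_I` is integral); `h^d∕d! = Σ_{|J|=d} E_{JJ}` is a primitive integral class.
  Hence for every coherent sheaf (every class of `K⁰_top`) with (A1)-clean `ch = Σ_d λ_d h^d∕d! + w`: `λ_d ∈ ℤ` (pair `ch_d` with one
  `E_{JJ}`; by (M2) `w` has no `E_{JJ}` component) and `w ∈ H⁸(P, ℤ)`.
With (M1)–(M3), §1–§2 say: **`w = μe⁴ + μ̄ē⁴ ∈ H⁸(P,ℤ) ⟺ μ ∈ 8ℤ[i]`** (LEMMA W), so **every (A1)-clean coherent sheaf on `P`, in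
ANY alphabet, has `μ ∈ 8ℤ[i]`** (COROLLARY W1).  §3 adds the rank-4 Newton closure (R4) (`StrengthenRank4Closure`:
`λ₈ − p₈(x) = |μ|²∕140`, cleared `× 840`) with INTEGER Newton data only (no support, no ladder): `35 ∣ |μ|²` universally, and with W:
**`μ ∈ 56(2 ± i)ℤ[i]`, `|μ|² ∈ 15680·ℕ`, `|μ| ≥ 56√5` for every integral (A1)∧(R4)-clean rank-4 class with `μ ≠ 0`** (PROPOSITION F),
attained by the class `λ = (4, 0, −24, −24, −24, 480, 2352, −3696, −30080)`, `μ = 112 + 56 i`; `Re μ = 0 ⟹ 280 ∣ m`, and with the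
half-sum law `32 ∣ m` this is exactly LAW L-1120 (`StrengthenArithmetic1120.m_mem_1120`) — consistent, no new floor on `◇_h`.

Evidence, not a rung: nothing here is proved toward HC ∕ HC_CM ∕ HC_AV ∕ №4 ∕ 26512 ∕ 18881 ∕ H2.  No `instance`, no `notation`,
Mathlib only; census-neutral.  A class ≠ a design ≠ a sheaf.
-/

set_option linter.dupNamespace false

namespace Summit.HodgeConjecture.HodgeConjecture.Cruxes.BlochSeedDiscOne.WeilLatticeLaw

/-! ## §1 The local model of `e_f = E_{z z′}` and the 256 coefficients of `e⁴` -/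

/-- `2·E_{z z′}` on the four mixed monomials of a factor pair, indexed `0 = dx∧dx′, 1 = dx∧dy′, 2 = dy∧dx′, 3 = dy∧dy′`
(modelling sentence (M1)): `(i, 1, −1, i)`. -/
def eCoeff2 : Fin 4 → GaussianInt := ![⟨0, 1⟩, ⟨1, 0⟩, ⟨-1, 0⟩, ⟨0, 1⟩]

/-- `2·E_{z′ z} = conj (2·E_{z z′})`. -/
def ebarCoeff2 (m : Fin 4) : GaussianInt := star (eCoeff2 m)

theorem ebarCoeff2_eq : ebarCoeff2 = ![⟨0, -1⟩, ⟨1, 0⟩, ⟨-1, 0⟩, ⟨0, -1⟩] := by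
  funext m; fin_cases m <;> rfl

/-- `16·(coefficient of e⁴ on the product monomial (m₀,m₁,m₂,m₃))` (modelling sentence (M2)). -/
def e4Coeff16 (m₀ m₁ m₂ m₃ : Fin 4) : GaussianInt := eCoeff2 m₀ * eCoeff2 m₁ * eCoeff2 m₂ * eCoeff2 m₃

/-- `16·(coefficient of ē⁴)`. -/
def ebar4Coeff16 (m₀ m₁ m₂ m₃ : Fin 4) : GaussianInt := ebarCoeff2 m₀ * ebarCoeff2 m₁ * ebarCoeff2 m₂ * ebarCoeff2 m₃

/-- `ē⁴` is the conjugate of `e⁴` monomial by monomial. -/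
theorem ebar4_eq_star (m₀ m₁ m₂ m₃ : Fin 4) : ebar4Coeff16 m₀ m₁ m₂ m₃ = star (e4Coeff16 m₀ m₁ m₂ m₃) := by
  simp only [ebar4Coeff16, e4Coeff16, ebarCoeff2, star_mul']

/-- every coefficient of `16·e⁴` is a UNIT of `ℤ[i]`: exactly one of `Re`, `Im` is `±1`, the other `0`. -/
theorem e4Coeff16_unit (m₀ m₁ m₂ m₃ : Fin 4) :
    e4Coeff16 m₀ m₁ m₂ m₃ = 1 ∨ e4Coeff16 m₀ m₁ m₂ m₃ = -1 ∨
      e4Coeff16 m₀ m₁ m₂ m₃ = ⟨0, 1⟩ ∨ e4Coeff16 m₀ m₁ m₂ m₃ = ⟨0, -1⟩ := by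
  revert m₀ m₁ m₂ m₃; decide

/-- `8·U` and `8·V` on a product monomial, where `U := e⁴ + ē⁴`, `V := i(e⁴ − ē⁴)` are the two REAL generators of `W`:
`16U = c + c̄ = 2 Re c`, `16V = i(c − c̄) = −2 Im c`. -/
def U8 (m₀ m₁ m₂ m₃ : Fin 4) : ℤ := (e4Coeff16 m₀ m₁ m₂ m₃).re

def V8 (m₀ m₁ m₂ m₃ : Fin 4) : ℤ := -(e4Coeff16 m₀ m₁ m₂ m₃).im

theorem sixteenU (m₀ m₁ m₂ m₃ : Fin 4) :
    e4Coeff16 m₀ m₁ m₂ m₃ + ebar4Coeff16 m₀ m₁ m₂ m₃ = ⟨2 * U8 m₀ m₁ m₂ m₃, 0⟩ := by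
  rw [ebar4_eq_star]; simp only [U8]
  ext
  · simp; ring
  · simp

theorem sixteenV (m₀ m₁ m₂ m₃ : Fin 4) :
    (⟨0, 1⟩ : GaussianInt) * (e4Coeff16 m₀ m₁ m₂ m₃ - ebar4Coeff16 m₀ m₁ m₂ m₃) = ⟨2 * V8 m₀ m₁ m₂ m₃, 0⟩ := by
  rw [ebar4_eq_star]; simp only [V8]
  ext
  · simp; ring
  · simp

/-- **LEMMA W, support half**: on every one of the 256 monomials exactly one of `U`, `V` is non-zero, with value `±1∕8`. -/
theorem UV_disjoint_pm (m₀ m₁ m₂ m₃ : Fin 4) :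
    (U8 m₀ m₁ m₂ m₃ = 0 ∧ (V8 m₀ m₁ m₂ m₃ = 1 ∨ V8 m₀ m₁ m₂ m₃ = -1)) ∨
      (V8 m₀ m₁ m₂ m₃ = 0 ∧ (U8 m₀ m₁ m₂ m₃ = 1 ∨ U8 m₀ m₁ m₂ m₃ = -1)) := by
  revert m₀ m₁ m₂ m₃; decide

/-- the `i`-carrying local monomials `dx∧dx′`, `dy∧dy′` (indices `0`, `3`). -/
def isDiag (m : Fin 4) : Bool := decide (m = 0 ∨ m = 3)

/-- support of `U` = an EVEN number of factors on `dx∧dx′`∕`dy∧dy′`, support of `V` = an ODD number; hence each support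
has `128 = 256∕2` monomials. -/
theorem U8_ne_zero_iff (m₀ m₁ m₂ m₃ : Fin 4) :
    U8 m₀ m₁ m₂ m₃ ≠ 0 ↔ (isDiag m₀ ^^ isDiag m₁ ^^ isDiag m₂ ^^ isDiag m₃) = false := by
  revert m₀ m₁ m₂ m₃; decide

theorem V8_ne_zero_iff (m₀ m₁ m₂ m₃ : Fin 4) :
    V8 m₀ m₁ m₂ m₃ ≠ 0 ↔ (isDiag m₀ ^^ isDiag m₁ ^^ isDiag m₂ ^^ isDiag m₃) = true := by
  revert m₀ m₁ m₂ m₃; decide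

set_option maxRecDepth 100000 in
theorem U_support_card :
    (Finset.univ.filter fun m : Fin 4 × Fin 4 × Fin 4 × Fin 4 => U8 m.1 m.2.1 m.2.2.1 m.2.2.2 ≠ 0).card = 128 := by
  decide

set_option maxRecDepth 100000 in
theorem V_support_card :
    (Finset.univ.filter fun m : Fin 4 × Fin 4 × Fin 4 × Fin 4 => V8 m.1 m.2.1 m.2.2.1 m.2.2.2 ≠ 0).card = 128 := by
  decide

/-! ## §2 LEMMA W: the Weil part is integral iff `μ ∈ 8ℤ[i]` -/

/-- `8 ×` the coefficient of `w = μe⁴ + μ̄ē⁴` (`μ = a + b i ∈ ℚ(i)`) on the product monomial: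
`16·w_m = μc + μ̄c̄ = 2 Re(μ c) = 2(a Re c − b Im c)`, i.e. `8·w_m = a·U8 + b·V8`. -/
def weilCoeff8 (a b : ℚ) (m₀ m₁ m₂ m₃ : Fin 4) : ℚ := a * U8 m₀ m₁ m₂ m₃ + b * V8 m₀ m₁ m₂ m₃

/-- the coefficient itself. -/
def weilCoeff (a b : ℚ) (m₀ m₁ m₂ m₃ : Fin 4) : ℚ := weilCoeff8 a b m₀ m₁ m₂ m₃ / 8

/-- calibration of the formula `16 w_m = μ c + μ̄ c̄` against `weilCoeff8` in `ℤ[i]`-arithmetic (integer `a, b`). -/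
theorem weilCoeff8_eq (a b : ℤ) (m₀ m₁ m₂ m₃ : Fin 4) :
    (⟨a, b⟩ : GaussianInt) * e4Coeff16 m₀ m₁ m₂ m₃ + (⟨a, -b⟩ : GaussianInt) * ebar4Coeff16 m₀ m₁ m₂ m₃
      = ⟨2 * (a * U8 m₀ m₁ m₂ m₃ + b * V8 m₀ m₁ m₂ m₃), 0⟩ := by
  rw [ebar4_eq_star]; simp only [U8, V8]
  ext <;> simp <;> ring

/-- the all-`dx∧dy′` monomial carries `U = +1∕8`, `V = 0` … -/
theorem probeU : U8 1 1 1 1 = 1 ∧ V8 1 1 1 1 = 0 := by decide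

/-- … and `(dx∧dx′, dx∧dy′, dx∧dy′, dx∧dy′)` carries `U = 0`, `V = −1∕8`. -/
theorem probeV : U8 0 1 1 1 = 0 ∧ V8 0 1 1 1 = -1 := by decide

/-- **LEMMA W.**  `W_ℚ ∩ H⁸(P, ℤ) = {μe⁴ + μ̄ē⁴ : μ ∈ 8ℤ[i]}`: the class `μe⁴ + μ̄ē⁴` (`μ = a + bi`, `a b : ℚ`) has integer
coefficients on all 256 monomials iff `a, b ∈ 8ℤ`. -/
theorem weil_integral_iff (a b : ℚ) :
    (∀ m₀ m₁ m₂ m₃ : Fin 4, ∃ n : ℤ, weilCoeff a b m₀ m₁ m₂ m₃ = n) ↔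
      (∃ a' : ℤ, a = 8 * a') ∧ (∃ b' : ℤ, b = 8 * b') := by
  constructor
  · intro h
    obtain ⟨n₁, h₁⟩ := h 1 1 1 1
    obtain ⟨n₂, h₂⟩ := h 0 1 1 1
    simp only [weilCoeff, weilCoeff8, probeU.1, probeU.2, probeV.1, probeV.2] at h₁ h₂
    push_cast at h₁ h₂
    refine ⟨⟨n₁, by linarith⟩, ⟨-n₂, by push_cast; linarith⟩⟩
  · rintro ⟨⟨a', rfl⟩, ⟨b', rfl⟩⟩ m₀ m₁ m₂ m₃
    refine ⟨a' * U8 m₀ m₁ m₂ m₃ + b' * V8 m₀ m₁ m₂ m₃, ?_⟩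
    simp only [weilCoeff, weilCoeff8]; push_cast; ring

/-- COROLLARY W1 in the shape the searches use: integer `μ = a + bi` with the Weil part integral has `8 ∣ a`, `8 ∣ b`. -/
theorem mu_mem_8 (a b : ℤ) (h : ∀ m₀ m₁ m₂ m₃ : Fin 4, (8:ℤ) ∣ a * U8 m₀ m₁ m₂ m₃ + b * V8 m₀ m₁ m₂ m₃) :
    (8:ℤ) ∣ a ∧ (8:ℤ) ∣ b := by
  have h₁ := h 1 1 1 1
  have h₂ := h 0 1 1 1
  rw [probeU.1, probeU.2] at h₁
  rw [probeV.1, probeV.2] at h₂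
  constructor <;> omega

/-! ## §3 PROPOSITION F: the universal rank-4 μ-floor (Newton closure (R4) + W) -/

/-- Newton's cleared elementary data of four formal roots from the power sums `λ₁ … λ₄`:
`e₁ = λ₁`, `d₂ = 2e₂`, `d₃ = 6e₃`, `d₄ = 24e₄` — integers as soon as `λ ∈ ℤ⁹` ((M3)). -/
def d2 (l1 l2 : ℤ) : ℤ := l1 ^ 2 - l2
def d3 (l1 l2 l3 : ℤ) : ℤ := l1 ^ 3 - 3 * l1 * l2 + 2 * l3
def d4 (l1 l2 l3 l4 : ℤ) : ℤ := l1 ^ 4 - 6 * l1 ^ 2 * l2 + 3 * l2 ^ 2 + 8 * l1 * l3 - 6 * l4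

/-- (R4) in the clean algebra, cleared of denominators: `c₅ = c₆ = c₇ = 0` ⟺ `24λ_d = 24(e₁λ_{d−1} − e₂λ_{d−2} + e₃λ_{d−3} − e₄λ_{d−4})`
(`d = 5, 6, 7`), and `c₈ = 0` ⟺ `840(λ₈ − p₈) = 6|μ|²` (`StrengthenRank4Closure`: `λ₈ = p₈ + |μ|²∕140`). -/
def R4Rows (l : Fin 9 → ℤ) (N : ℤ) : Prop :=
  24 * l 5 = 24 * l 1 * l 4 - 12 * d2 (l 1) (l 2) * l 3 + 4 * d3 (l 1) (l 2) (l 3) * l 2 - d4 (l 1) (l 2) (l 3) (l 4) * l 1 ∧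
  24 * l 6 = 24 * l 1 * l 5 - 12 * d2 (l 1) (l 2) * l 4 + 4 * d3 (l 1) (l 2) (l 3) * l 3 - d4 (l 1) (l 2) (l 3) (l 4) * l 2 ∧
  24 * l 7 = 24 * l 1 * l 6 - 12 * d2 (l 1) (l 2) * l 5 + 4 * d3 (l 1) (l 2) (l 3) * l 4 - d4 (l 1) (l 2) (l 3) (l 4) * l 3 ∧
  6 * N = 840 * l 8 - 840 * l 1 * l 7 + 420 * d2 (l 1) (l 2) * l 6 - 140 * d3 (l 1) (l 2) (l 3) * l 5
    + 35 * d4 (l 1) (l 2) (l 3) (l 4) * l 4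

/-- **`35 ∣ |μ|²` universally**: the degree-8 row alone, with integer Newton data (any alphabet, any support). -/
theorem normSq_dvd_35 (N e₁ D₂ D₃ D₄ l4 l5 l6 l7 l8 : ℤ)
    (h : 6 * N = 840 * l8 - 840 * e₁ * l7 + 420 * D₂ * l6 - 140 * D₃ * l5 + 35 * D₄ * l4) : (35:ℤ) ∣ N := by
  have : (35:ℤ) ∣ 6 * N := ⟨24 * l8 - 24 * e₁ * l7 + 12 * D₂ * l6 - 4 * D₃ * l5 + D₄ * l4, by rw [h]; ring⟩
  omega

theorem normSq_dvd_35' (l : Fin 9 → ℤ) (N : ℤ) (h : R4Rows l N) : (35:ℤ) ∣ N :=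
  normSq_dvd_35 N (l 1) _ _ _ (l 4) (l 5) (l 6) (l 7) (l 8) h.2.2.2

/-- `7 ≡ 3 (mod 4)` is inert in `ℤ[i]`. -/
theorem seven_dvd_of_dvd_normSq (x y : ℤ) (h : (7:ℤ) ∣ x ^ 2 + y ^ 2) : (7:ℤ) ∣ x ∧ (7:ℤ) ∣ y := by
  have key : ∀ u v : ZMod 7, u ^ 2 + v ^ 2 = 0 → u = 0 ∧ v = 0 := by decide
  have hx := (ZMod.intCast_zmod_eq_zero_iff_dvd (x ^ 2 + y ^ 2) 7).mpr h
  push_cast at hx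
  obtain ⟨hu, hv⟩ := key _ _ hx
  exact ⟨(ZMod.intCast_zmod_eq_zero_iff_dvd x 7).mp hu, (ZMod.intCast_zmod_eq_zero_iff_dvd y 7).mp hv⟩

/-- `5 ∣ y²  ⟹ 5 ∣ y`. -/
theorem five_dvd_of_dvd_sq (y : ℤ) (h : (5:ℤ) ∣ y ^ 2) : (5:ℤ) ∣ y :=
  Int.Prime.dvd_pow' (by norm_num) h

/-- **PROPOSITION F (universal rank-4 μ-lattice).**  `8 ∣ a, 8 ∣ b` (W) and `35 ∣ a² + b²` ((R4), degree 8) force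
`a = 56x`, `b = 56y` with `5 ∣ x² + y²`, i.e. `μ ∈ 56(2+i)ℤ[i] ∪ 56(2−i)ℤ[i]`. -/
theorem mu_mem_56 (a b : ℤ) (ha : (8:ℤ) ∣ a) (hb : (8:ℤ) ∣ b) (h35 : (35:ℤ) ∣ a ^ 2 + b ^ 2) :
    ∃ x y : ℤ, a = 56 * x ∧ b = 56 * y ∧ (5:ℤ) ∣ x ^ 2 + y ^ 2 := by
  obtain ⟨⟨u, rfl⟩, ⟨v, rfl⟩⟩ := seven_dvd_of_dvd_normSq a b (dvd_trans (by norm_num) h35)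
  have hu : (8:ℤ) ∣ u := by
    have : IsCoprime (8:ℤ) 7 := by rw [Int.isCoprime_iff_gcd_eq_one]; decide
    exact this.dvd_of_dvd_mul_left ha
  have hv : (8:ℤ) ∣ v := by
    have : IsCoprime (8:ℤ) 7 := by rw [Int.isCoprime_iff_gcd_eq_one]; decide
    exact this.dvd_of_dvd_mul_left hb
  obtain ⟨x, rfl⟩ := hu; obtain ⟨y, rfl⟩ := hv
  refine ⟨x, y, by ring, by ring, ?_⟩
  have h5 : (5:ℤ) ∣ (7 * (8 * x)) ^ 2 + (7 * (8 * y)) ^ 2 := dvd_trans (by norm_num) h35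
  have : (7 * (8 * x)) ^ 2 + (7 * (8 * y)) ^ 2 = 3136 * (x ^ 2 + y ^ 2) := by ring
  rw [this] at h5
  exact (Int.isCoprime_iff_gcd_eq_one.mpr (by decide) : IsCoprime (5:ℤ) 3136).dvd_of_dvd_mul_left h5

/-- the floor: `|μ|² ∈ 15680·ℕ`, so `μ ≠ 0 ⟹ |μ|² ≥ 15680` (`|μ| ≥ 56√5 ≈ 125.2`). -/
theorem normSq_floor (a b : ℤ) (ha : (8:ℤ) ∣ a) (hb : (8:ℤ) ∣ b) (h35 : (35:ℤ) ∣ a ^ 2 + b ^ 2) :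
    (15680:ℤ) ∣ a ^ 2 + b ^ 2 ∧ ((a ≠ 0 ∨ b ≠ 0) → 15680 ≤ a ^ 2 + b ^ 2) := by
  obtain ⟨x, y, rfl, rfl, ⟨k, hk⟩⟩ := mu_mem_56 a b ha hb h35
  have hN : (56 * x) ^ 2 + (56 * y) ^ 2 = 15680 * k := by linear_combination 3136 * hk
  refine ⟨⟨k, hN⟩, fun hne => ?_⟩
  rw [hN]
  have hk0 : 0 < k := by
    rcases hne with hx | hy
    · have : x ≠ 0 := by rintro rfl; simp at hx
      nlinarith [sq_nonneg y, pow_pos (show 0 < x ^ 2 from by positivity) 1]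
    · have : y ≠ 0 := by rintro rfl; simp at hy
      nlinarith [sq_nonneg x, pow_pos (show 0 < y ^ 2 from by positivity) 1]
  linarith

/-- PROPOSITION F from the raw rows: integer clean class, (R4) rows, Weil part in `8ℤ[i]`. -/
theorem propF (l : Fin 9 → ℤ) (a b : ℤ) (hW : (8:ℤ) ∣ a ∧ (8:ℤ) ∣ b) (hR4 : R4Rows l (a ^ 2 + b ^ 2)) :
    (∃ x y : ℤ, a = 56 * x ∧ b = 56 * y ∧ (5:ℤ) ∣ x ^ 2 + y ^ 2) ∧ (15680:ℤ) ∣ a ^ 2 + b ^ 2 ∧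
      ((a ≠ 0 ∨ b ≠ 0) → 15680 ≤ a ^ 2 + b ^ 2) :=
  have h35 := normSq_dvd_35' l _ hR4
  ⟨mu_mem_56 a b hW.1 hW.2 h35, normSq_floor a b hW.1 hW.2 h35⟩

/-- the floor is ATTAINED at class level: `λ = (4, 0, −24, −24, −24, 480, 2352, −3696, −30080)`, `μ = 112 + 56i`
(`|μ|² = 15680`; Newton data `e = (0, 12, −8, 78)`; all four (R4) rows hold exactly). -/
theorem floor_attained :
    R4Rows ![4, 0, -24, -24, -24, 480, 2352, -3696, -30080] (112 ^ 2 + 56 ^ 2) ∧ (112:ℤ) ^ 2 + 56 ^ 2 = 15680 ∧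
      (8:ℤ) ∣ 112 ∧ (8:ℤ) ∣ 56 := by
  refine ⟨?_, by norm_num, by norm_num, by norm_num⟩
  simp only [R4Rows, d2, d3, d4]
  decide

/-- Newton data of the attained class: `e₁ = 0`, `2e₂ = 24`, `6e₃ = −48`, `24e₄ = 1872` (`e = (0, 12, −8, 78)`). -/
example : d2 0 (-24) = 24 ∧ d3 0 (-24) (-24) = -48 ∧ d4 0 (-24) (-24) (-24) = 1872 := by decide

/-- `Re μ = 0` form (every LINE∕BAND support of record): `8 ∣ m`, `35 ∣ m²` ⟹ `280 ∣ m` — COROLLARY W2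
(sharpens K-R4-140's `140 ∣ m` by the factor 2 that W contributes). -/
theorem m_mem_280 (m : ℤ) (h8 : (8:ℤ) ∣ m) (h35 : (35:ℤ) ∣ m ^ 2) : (280:ℤ) ∣ m := by
  obtain ⟨x, y, hx, hy, h5⟩ := mu_mem_56 0 m (dvd_zero 8) h8 (by simpa using h35)
  have hx0 : x = 0 := by omega
  subst hx0
  have h5y : (5:ℤ) ∣ y := five_dvd_of_dvd_sq y (by simpa using h5)
  obtain ⟨z, rfl⟩ := h5y
  exact ⟨z, by rw [hy]; ring⟩

/-- consistency with LAW L-1120 (`StrengthenArithmetic1120.m_mem_1120`): on `◇_h` supports the half-sum law adds `32 ∣ m`,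
and `280 ∣ m ∧ 32 ∣ m ⟺ 1120 ∣ m` — PROPOSITION F gives no finer floor there (and `m = 1120` is attained at class level,
`starClass_m1120`), its content is support-freeness. -/
theorem m_mem_1120_iff (m : ℤ) : ((280:ℤ) ∣ m ∧ (32:ℤ) ∣ m) ↔ (1120:ℤ) ∣ m := by
  constructor
  · rintro ⟨h1, h2⟩; omega
  · intro h; constructor <;> omega

/-- sanity: `1120 i`, `2240 i` and the attained `112 + 56i` all lie in `56(2+i)ℤ[i] ∪ 56(2−i)ℤ[i]`
(`1120i = 56(2+i)(4+8i)`, `112+56i = 56(2+i)·1`). -/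
example : (⟨0, 1120⟩ : GaussianInt) = ⟨56, 0⟩ * ⟨2, 1⟩ * ⟨4, 8⟩ ∧ (⟨112, 56⟩ : GaussianInt) = ⟨56, 0⟩ * ⟨2, 1⟩ := by
  decide

end Summit.HodgeConjecture.HodgeConjecture.Cruxes.BlochSeedDiscOne.WeilLatticeLaw
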